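import Summits.Schanuel.Schanuel.Theorems.ZilberEacExplosionEstimates
import HarnessLib

/-!
# The exp–exp balance in several variables, IV: estimates on the region around the root

Zilber's Exponential-Algebraic Closedness, case ladder (host summit Schanuel, cell `pub-schanuel`,
seat 2, gen 10).  The two hypotheses of the contraction step `exists_solution_nearLine_step` that
involve the base polynomial `g` and the targets `Aⱼ`, bounded on the region
`‖x₀ - z₀‖ ≤ 1`, `‖x_{j+1} - λⱼx₀ - νⱼ‖ ≤ δ` around a root `z₀` with `Re z₀ ≥ r/4`, `‖z₀‖ ≤ 5r/4`:

* `offline_error_le` — `‖g(x(ξ)) - g(ℓ(z₀ + lξ₀))‖ ≤ C_g (4(2+‖λ‖+‖ν‖))^N r^N δ`;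
* `perturbation_le_on_region` — `‖(Aⱼ(x) + u f̃ⱼ(u)) e^{ζ - xⱼ}‖ ≤ (B_A((1+C_x)r)^{N_A} + B_t) ·
  e^{-(λ_min(r/4-1) - ‖ν‖ - 1 - R - L_c)/e_max}` (from `perturbation_bound_of_cue` and the region
  control of `ZilberEacExplosionEstimates`);
* `tendsto_pow_mul_exp_neg_of_tendsto` — `r^N e^{-a r + C} → 0` along `r → ∞`;
* `two_pi_mul_sub_le_norm` — `‖2πiσ e i + c‖ ≥ 2π i - ‖c‖` (`σ = ±1`, `e ≥ 1`).

HONEST FRAMING: auxiliary analysis; nothing here bears on Schanuel's conjecture; EAC ⇏ SC.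
-/

noncomputable section

open Complex MvPolynomial Filter Topology Metric
open Literature.NumberTheory.Transcendental Literature.ModelTheory.Zilber

set_option linter.dupNamespace false

namespace Summit.Schanuel.Schanuel.Theorems

section Region

variable {s : ℕ}

/-- `‖2πiσ e i + c‖ ≥ 2π i - ‖c‖` for `σ = ±1`, `e ≥ 1`, `i ∈ ℕ`. [folklore] -/
theorem two_pi_mul_sub_le_norm {σ : ℤ} (hσ : σ = 1 ∨ σ = -1) {e : ℕ} (he : 1 ≤ e) (i : ℕ)
    (c : ℂ) : 2 * Real.pi * i - ‖c‖ ≤ ‖(2 * Real.pi * I * σ * (e : ℂ) * (i : ℂ) + c : ℂ)‖ := by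
  have hσabs : |(σ : ℝ)| = 1 := by rcases hσ with h | h <;> simp [h]
  have heR : (1 : ℝ) ≤ e := by exact_mod_cast he
  have hn1 : ‖(2 * Real.pi * I * σ * (e : ℂ) * (i : ℂ) : ℂ)‖ = 2 * Real.pi * e * i := by
    rw [show (2 * Real.pi * I * σ * (e : ℂ) * (i : ℂ) : ℂ) =
        ((σ * (2 * Real.pi * e * i) : ℝ) : ℂ) * I by push_cast; ring,
      norm_mul, Complex.norm_I, mul_one, Complex.norm_real, Real.norm_eq_abs, abs_mul, hσabs,
      one_mul, abs_of_nonneg (by positivity)]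
  have h2 : 2 * Real.pi * i ≤ 2 * Real.pi * e * i := by
    have h := mul_le_mul_of_nonneg_left heR (by positivity : (0 : ℝ) ≤ 2 * Real.pi * i)
    calc 2 * Real.pi * i = 2 * Real.pi * i * 1 := (mul_one _).symm
      _ ≤ 2 * Real.pi * i * e := h
      _ = 2 * Real.pi * e * i := by ring
  have h3 := norm_sub_norm_le (2 * Real.pi * I * σ * (e : ℂ) * (i : ℂ) : ℂ) (-c)
  rw [sub_neg_eq_add, norm_neg, hn1] at h3
  linarith

/-- `r^N e^{-(a r) + C} → 0` along any `r → ∞` (`a > 0`). [folklore] -/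
theorem tendsto_pow_mul_exp_neg_of_tendsto {r : ℕ → ℝ} (hr : Tendsto r atTop atTop) {a : ℝ}
    (ha : 0 < a) (N : ℕ) (C : ℝ) :
    Tendsto (fun i => r i ^ N * Real.exp (-(a * r i) + C)) atTop (𝓝 0) := by
  have h1 : Tendsto (fun i => a * r i) atTop atTop := hr.const_mul_atTop ha
  have h2 := ((Real.tendsto_pow_mul_exp_neg_atTop_nhds_zero N).comp h1).const_mul
    (Real.exp C / a ^ N)
  rw [mul_zero] at h2
  refine h2.congr fun i => ?_
  simp only [Function.comp]
  rw [mul_pow, Real.exp_add]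
  field_simp

/-- **Off-line error.**  With the increment bound `‖g(a+u) - g(a)‖ ≤ C_g‖u‖(1+‖a‖)^N(1+‖u‖)^N`,
for `r ≥ 4`, `‖z₀‖ ≤ 5r/4`, `‖l‖ ≤ 1`, `0 < δ ≤ 1`, `‖ξ‖ ≤ 1`:
`‖g(x(ξ)) - g(ℓ(z₀ + lξ₀))‖ ≤ C_g (4(2 + ‖λ‖ + ‖ν‖))^N r^N δ`. [folklore] -/
theorem offline_error_le (g : MvPolynomial (Fin (s + 1)) ℂ) {Cg : ℝ} {Ng : ℕ} (hCg : 0 ≤ Cg)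
    (hg : ∀ a u : Fin (s + 1) → ℂ,
      ‖eval (a + u) g - eval a g‖ ≤ Cg * ‖u‖ * (1 + ‖a‖) ^ Ng * (1 + ‖u‖) ^ Ng)
    (lam ν : Fin s → ℂ) {z₀ l : ℂ} {r δ : ℝ} (hr : 4 ≤ r) (hzup : ‖z₀‖ ≤ 5 / 4 * r)
    (hl : ‖l‖ ≤ 1) (hδ0 : 0 < δ) (hδ1 : δ ≤ 1) (ξ : Fin (s + 1) → ℂ) (hξ : ‖ξ‖ ≤ 1) :
    ‖eval (Fin.cons (z₀ + l * ξ 0) (fun j => lam j * (z₀ + l * ξ 0) + ν j + δ * ξ j.succ) :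
          Fin (s + 1) → ℂ) g -
        eval (Fin.cons (z₀ + l * ξ 0) (fun j => lam j * (z₀ + l * ξ 0) + ν j) :
          Fin (s + 1) → ℂ) g‖ ≤
      Cg * (4 * (2 + ‖lam‖ + ‖ν‖)) ^ Ng * r ^ Ng * δ := by
  set zf : ℂ := z₀ + l * ξ 0 with hzf
  set a : Fin (s + 1) → ℂ := Fin.cons zf (fun j => lam j * zf + ν j) with ha
  set u : Fin (s + 1) → ℂ := Fin.cons 0 (fun j => (δ : ℂ) * ξ j.succ) with hu
  have hxu : (Fin.cons zf (fun j => lam j * zf + ν j + δ * ξ j.succ) : Fin (s + 1) → ℂ) = a + u := by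
    funext i
    refine Fin.cases ?_ (fun j => ?_) i
    · simp [ha, hu]
    · simp [ha, hu]
  rw [hxu]
  have hξi : ∀ i, ‖ξ i‖ ≤ 1 := fun i => (norm_le_pi_norm ξ i).trans hξ
  have hun : ‖u‖ ≤ δ := by
    refine (pi_norm_le_iff_of_nonneg hδ0.le).2 fun i => ?_
    refine Fin.cases ?_ (fun j => ?_) i
    · simp [hu, hδ0.le]
    · simp only [hu, Fin.cons_succ, norm_mul, Complex.norm_real, Real.norm_eq_abs, abs_of_pos hδ0]
      nlinarith [hξi j.succ]
  have hzfn : ‖zf‖ ≤ 3 / 2 * r := by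
    have h1 : ‖zf‖ ≤ ‖z₀‖ + ‖l * ξ 0‖ := norm_add_le _ _
    have h2 : ‖l * ξ 0‖ ≤ 1 := by
      rw [norm_mul]; nlinarith [hξi 0, norm_nonneg l, norm_nonneg (ξ 0)]
    linarith
  have hlam0 : 0 ≤ ‖lam‖ := norm_nonneg _
  have hν0 : 0 ≤ ‖ν‖ := norm_nonneg _
  have han : ‖a‖ ≤ (1 + ‖lam‖) * ‖zf‖ + ‖ν‖ := by
    refine (pi_norm_le_iff_of_nonneg (by positivity)).2 fun i => ?_
    refine Fin.cases ?_ (fun j => ?_) i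
    · simp only [ha, Fin.cons_zero]
      nlinarith [norm_nonneg zf]
    · simp only [ha, Fin.cons_succ]
      calc ‖lam j * zf + ν j‖ ≤ ‖lam j‖ * ‖zf‖ + ‖ν j‖ := by
            refine (norm_add_le _ _).trans ?_; rw [norm_mul]
        _ ≤ ‖lam‖ * ‖zf‖ + ‖ν‖ := by
            gcongr
            · exact norm_le_pi_norm lam j
            · exact norm_le_pi_norm ν j
        _ ≤ (1 + ‖lam‖) * ‖zf‖ + ‖ν‖ := by nlinarith [norm_nonneg zf]
  have h1a : 1 + ‖a‖ ≤ 2 * (2 + ‖lam‖ + ‖ν‖) * r := by nlinarith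
  have h1u : 1 + ‖u‖ ≤ 2 := by linarith
  have hpa : (1 + ‖a‖) ^ Ng ≤ (2 * (2 + ‖lam‖ + ‖ν‖) * r) ^ Ng :=
    pow_le_pow_left₀ (by positivity) h1a _
  have hpu : (1 + ‖u‖) ^ Ng ≤ 2 ^ Ng := pow_le_pow_left₀ (by positivity) h1u _
  calc ‖eval (a + u) g - eval a g‖ ≤ Cg * ‖u‖ * (1 + ‖a‖) ^ Ng * (1 + ‖u‖) ^ Ng := hg a u
    _ ≤ Cg * δ * (2 * (2 + ‖lam‖ + ‖ν‖) * r) ^ Ng * 2 ^ Ng := by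
        gcongr
    _ = Cg * (4 * (2 + ‖lam‖ + ‖ν‖)) ^ Ng * r ^ Ng * δ := by
        have h4 : (4 * (2 + ‖lam‖ + ‖ν‖)) ^ Ng = (2 * (2 + ‖lam‖ + ‖ν‖)) ^ Ng * 2 ^ Ng := by
          rw [← mul_pow]; congr 1; ring
        rw [h4, mul_pow]
        ring

/-- **Perturbation bound on the region.**  For a fibre `j`: with the uniform growth bound of the
targets, the region `‖x₀ - z₀‖ ≤ 1`, `‖x_{i+1} - λᵢx₀ - νᵢ‖ ≤ 1` (`Re z₀ ≥ r/4`, `‖z₀‖ ≤ 5r/4`,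
`r ≥ 4`, real slopes `λᵢ ≥ λ_min`, `0 < λ_min ≤ 1`), `‖ζ‖ ≤ R`, the cue
`lc(fⱼ) u^{eⱼ} = e^{xⱼ - ζ}`, and the threshold `R + L_c ≤ λ_min(r/4 - 1) - ‖ν‖ - 1`
(`L_c ≥ |log|lc fⱼ||`, `B_t ≥ B̃ⱼ/|lc fⱼ|`, `eⱼ ≤ e_max`):
`‖(Aⱼ(x) + u f̃ⱼ(u)) e^{ζ - xⱼ}‖ ≤ (B_A((1 + C_x) r)^{N_A} + B_t) e^{-(λ_min(r/4-1) - ‖ν‖ - 1 - R - L_c)/e_max}`,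
`C_x = 3 + 3‖λ‖ + ‖ν‖`. [folklore] -/
theorem perturbation_le_on_region (A : Fin (s + 1) → MvPolynomial (Fin (s + 1)) ℂ)
    {BA : ℝ} {NA : ℕ} (hBA : 0 ≤ BA)
    (hA : ∀ j, ∀ y : Fin (s + 1) → ℂ, ‖eval y (A j)‖ ≤ BA * (1 + ‖y‖) ^ NA)
    (F : Polynomial ℂ) (hF : F ≠ 0) {Lc Bt : ℝ} {emax : ℕ}
    (hLc : |Real.log ‖F.leadingCoeff‖| ≤ Lc) (hBt : coeffNormSum F.eraseLead / ‖F.leadingCoeff‖ ≤ Bt)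
    (hej : F.natDegree + 1 ≤ emax)
    {z₀ : ℂ} {r : ℝ} (hr : 4 ≤ r) (hre : r / 4 ≤ z₀.re) (hz : ‖z₀‖ ≤ 5 / 4 * r)
    {lam : Fin s → ℂ} {lmin : ℝ} (hlmin : 0 < lmin) (hlmin1 : lmin ≤ 1)
    (hlam_im : ∀ j, (lam j).im = 0) (hlam_re : ∀ j, lmin ≤ (lam j).re) (ν : Fin s → ℂ)
    {x : Fin (s + 1) → ℂ} (hx0 : ‖x 0 - z₀‖ ≤ 1)
    (hxs : ∀ j : Fin s, ‖x j.succ - lam j * x 0 - ν j‖ ≤ 1) (j : Fin (s + 1))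
    {ζ u : ℂ} {R : ℝ} (hζ : ‖ζ‖ ≤ R)
    (hcue : F.leadingCoeff * u ^ (F.natDegree + 1) = exp (x j - ζ))
    (hthr : R + Lc ≤ lmin * (r / 4 - 1) - ‖ν‖ - 1) :
    ‖(eval x (A j) + u * F.eraseLead.eval u) * exp (ζ - x j)‖ ≤
      (BA * ((1 + (3 + 3 * ‖lam‖ + ‖ν‖)) * r) ^ NA + Bt) *
        Real.exp (-((lmin * (r / 4 - 1) - ‖ν‖ - 1 - R - Lc) / emax)) := by
  set ρ : ℝ := lmin * (r / 4 - 1) - ‖ν‖ - 1 with hρ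
  set Cx : ℝ := 3 + 3 * ‖lam‖ + ‖ν‖ with hCx
  have hlam0 : 0 ≤ ‖lam‖ := norm_nonneg _
  have hν0 : 0 ≤ ‖ν‖ := norm_nonneg _
  have hCx0 : 0 ≤ Cx := by positivity
  have hc0 : F.leadingCoeff ≠ 0 := Polynomial.leadingCoeff_ne_zero.2 hF
  have hcpos : 0 < ‖F.leadingCoeff‖ := norm_pos_iff.2 hc0
  have hBt0 : 0 ≤ Bt := le_trans (div_nonneg (coeffNormSum_nonneg _) hcpos.le) hBt
  have hLc0 : 0 ≤ Lc := (abs_nonneg _).trans hLc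
  have hlog : Real.log ‖F.leadingCoeff‖ ≤ Lc := (le_abs_self _).trans hLc
  have hemax1 : (1 : ℝ) ≤ emax := by exact_mod_cast (show 1 ≤ emax by omega)
  have hejR : (F.natDegree + 1 : ℝ) ≤ emax := by exact_mod_cast hej
  have hej1 : (1 : ℝ) ≤ (F.natDegree + 1 : ℝ) := by
    have : (0 : ℝ) ≤ F.natDegree := Nat.cast_nonneg _
    linarith
  -- region control
  have hrej := region_re_lower hr hre hlmin hlmin1 hlam_im hlam_re ν hx0 hxs j
  have hxn := region_norm_le hr hz lam ν hx0 hxs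
  rw [← hρ] at hrej
  have hxR : R + Real.log ‖F.leadingCoeff‖ ≤ (x j).re := by linarith
  have hb := perturbation_bound_of_cue F hF (a := eval x (A j)) hζ hxR hcue
  refine hb.trans ?_
  -- the two exponentials against `e^{-(ρ - R - Lc)/emax}`
  have hq0 : 0 ≤ ρ - R - Lc := by linarith
  set E : ℝ := Real.exp (-((ρ - R - Lc) / emax)) with hE
  have hE1 : Real.exp (R - (x j).re) ≤ E := by
    refine Real.exp_le_exp.2 ?_
    have h1 : (ρ - R - Lc) / emax ≤ ρ - R - Lc := div_le_self hq0 hemax1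
    linarith
  have hE2 : Real.exp (-(((x j).re - R - Real.log ‖F.leadingCoeff‖) / (F.natDegree + 1))) ≤ E := by
    refine Real.exp_le_exp.2 (neg_le_neg ?_)
    calc (ρ - R - Lc) / emax ≤ (ρ - R - Lc) / (F.natDegree + 1 : ℝ) :=
          div_le_div_of_nonneg_left hq0 (by positivity) hejR
      _ ≤ ((x j).re - R - Real.log ‖F.leadingCoeff‖) / (F.natDegree + 1 : ℝ) :=
          div_le_div_of_nonneg_right (by linarith) (by positivity)
  have hApart : ‖eval x (A j)‖ ≤ BA * ((1 + Cx) * r) ^ NA := by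
    refine (hA j x).trans (mul_le_mul_of_nonneg_left (pow_le_pow_left₀ (by positivity) ?_ _) hBA)
    rw [hCx]; nlinarith
  have hEpos : 0 < E := Real.exp_pos _
  calc ‖eval x (A j)‖ * Real.exp (R - (x j).re) +
        coeffNormSum F.eraseLead / ‖F.leadingCoeff‖ *
          Real.exp (-(((x j).re - R - Real.log ‖F.leadingCoeff‖) / (F.natDegree + 1)))
      ≤ BA * ((1 + Cx) * r) ^ NA * E + Bt * E := by
        gcongr
    _ = (BA * ((1 + Cx) * r) ^ NA + Bt) * E := by ring

end Region

end Summit.Schanuel.Schanuel.Theorems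

end
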